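/-
Copyright: statement-level skeleton of a published paper (lit-balaban cell, reader/typer r15). No proof claims beyond
what the kernel checks below.
-/
import Literature.MathematicalPhysics.QuantumFieldTheory.BalabanImbrieJaffe1984to88.BIJ85Sect1Model

/-!
# BIJ85 — T. Bałaban, J. Imbrie, A. Jaffe, *Renormalization of the Higgs model: minimizers, propagators and the stability
of mean field theory*, CMP **97** (1985) 299–329 [BalabanImbrieJaffe1985]: the plaquette field (6.3), the translation (6.2),
the small-field decomposition (6.4) and the Wilson-action expansion (3.13)–(3.14)

statement-level skeleton of published theorems with citation tags; proofs where landed; nothing here is a claim about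
the Yang–Mills mass gap

Source: held text `paper:balaban1985-cmp97-bij-higgs-minimizers` (journal page = PDF page + 298); renders of p. 307 and
p. 318 read as images (`HOME/lit-balaban-r15/pages/1985-cmp97-bij-higgs-minimizers-p009,p020-x2.png`).  Rows
**C1.Eq6.1-6.4** and **C1.Eq3.13-3.14** of `HOME/lit-balaban-r15/ROWS-C1.md` (reader/typer r15, fold owner of C1).  CARRIERS OF
RECORD: `BIJ85Sect1Model` (u : `PBond P j → Circle`, `plaq`, the branch `argB` of (2.11), `wilson_quadratic_approx` of p. 301).

THE PRINTED TEXT (verbatim).  p. 318 [PDF 20]: *"on the unit lattice let u = u′Q^{s*}v, u′ = exp(ie_kB′). (6.2) The plaquette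
field f^{(k)}(p) = (ie_k)^{−1} ln u(∂p), p ∈ T₁, (6.3) then decomposes as f^{(k)}(p) = (ie_k)^{−1} ln u′(∂p) + (ie_k)^{−1}
ln(Q^{s*}v)(∂p) = (∂B′)(p) + L^{−d/2}(Q^{e*}f^{(k+1)})(p), (6.4) which is valid as long as u′(p) and (Q^{s*}_kv)(p) are close
to 1. … In this paper we are concerned with the small field regions which give the dominant contributions to the integral. In
this region the identity (6.4) holds."*  p. 307 [PDF 9]: *"Then the Wilson action can be written Σ_{p∈T₁} e(ε)^{−2}(1 − Re u(p))
= ½Σ_{p∈T₁}|∂A′ + L^{−d/2}Q^{e*}F|² + O(e(ε)²). (3.13) Here we define the L-lattice field F(p′) in terms of v(p′), where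
v(p′) ≡ Π_{b′∈∂p′} v_{b′} ≡ exp[ie(Lε)F(p′)]. (3.14)"*; p. 301 [PDF 3]: *"for small f_p, Σ_p e(ε)^{−2}(1 − Re u(p)) = Σ_p ½f_p² +
O(e(ε)²)"*.

WHAT IS TYPED / PROVED.  §1 the branch: `argB` is additive for two factors with arguments in (−π/2, π/2) (`argB_mul_of_small`,
Mathlib `Complex.arg_mul`) and `argB(e^{it}) = t` on [−π, π) (`argB_exp_mul_I`).  §2 **(6.3)** = (4.2.4) = (3.14): the plaquette
field f(p) = (ie)^{−1} ln u(∂p) := argB(u(p))/e (`plaqField`, with e^{ief(p)} = u(p) `exp_plaqField`, Re u(p) = cos(ef(p))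
`re_plaq_eq_cos`).  §3 **(6.2)**: the translation u = u′·w with w = Q^{s*}v a supplied U(1) bond field (`translate62`;
u(p) = u′(p)w(p), `plaq_translate62`) and u′ = exp(ieB′) (`expField`; u′(p) = exp(ie(∂B′)(p)), `plaq_expField`, with the
unit-spacing plaquette sum `curl1`).  §4 **(6.4)** PROVED in the small-field region: f_u(p) = f_{u′}(p) + f_w(p) whenever
|arg u′(p)|, |arg w(p)| < π/2 (`eq64_smallField`), and (ie)^{−1} ln u′(∂p) = (∂B′)(p) whenever |e(∂B′)(p)| < π
(`plaqField_expField`).  §5 **(3.13)** PROVED with an explicit constant: |Σ_p e^{−2}(1 − Re u(p)) − ½Σ_p f(p)²| ≤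
(5/96)e²Σ_p f(p)⁴ in the small-field region |ef(p)| ≤ 1 (`eq313`), and with the split f = f_{u′} + f_w of (6.4)/(3.9)–(3.12)
inserted (`eq313_split`).  TRANSCRIPT NOTES.  T1: the identification of the second summand f_w = (ie)^{−1}ln(Q^{s*}v)(∂p) with
L^{−d/2}(Q^{e*}f^{(k+1)})(p) (resp. L^{−d/2}Q^{e*}F in (3.13)) uses ∂Q^{s*}_k = Q^{e*}_k∂ (p. 317, p. 323) and the scaling
(2.26); it is NOT performed here (w is any U(1) field).  T2: (6.1) (the k-th step integral) is not typed.  T3: the O(e(ε)²) of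
(3.13) is made explicit per plaquette by p. 301's expansion; "small field" = |ef(p)| ≤ 1.  NOTHING beyond the kernel-checked
statements below is asserted.
-/

open scoped BigOperators

namespace Literature.MathematicalPhysics.QuantumFieldTheory.BalabanImbrieJaffe1984to88.BIJ85SmallFieldSplit64

noncomputable section

open Literature.MathematicalPhysics.QuantumFieldTheory.Balaban1983to89
open BIJ85Sect1Model Real

variable {P : Params} {j : ℕ}

/-! ## 1. The branch (2.11): additivity near 1 and the value on exponentials -/

/-- kernel: away from the cut u = −1 the printed branch is Mathlib's principal argument. [cite: BalabanImbrieJaffe1985, (2.11) p.303] -/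
theorem argB_eq_arg {z : ℂ} (h : Complex.arg z ≠ π) : argB z = Complex.arg z := by
  simp [argB, h]

/-- kernel: for two factors with arguments in (−π/2, π/2) the branch (2.11) is additive — the mechanism of *"(6.4) … valid as
long as u′(p) and (Q^{s*}_kv)(p) are close to 1"*. [cite: BalabanImbrieJaffe1985, (6.4) p.318] -/
theorem argB_mul_of_small {z w : ℂ} (hz : z ≠ 0) (hw : w ≠ 0) (hz' : |Complex.arg z| < π / 2)
    (hw' : |Complex.arg w| < π / 2) : argB (z * w) = argB z + argB w := by
  obtain ⟨hz1, hz2⟩ := abs_lt.mp hz'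
  obtain ⟨hw1, hw2⟩ := abs_lt.mp hw'
  have hsum : Complex.arg z + Complex.arg w ∈ Set.Ioc (-π) π := ⟨by linarith, by linarith⟩
  have hmul : Complex.arg (z * w) = Complex.arg z + Complex.arg w := Complex.arg_mul hz hw hsum
  have h1 : Complex.arg z ≠ π := by intro h; rw [h] at hz2; linarith [pi_pos]
  have h2 : Complex.arg w ≠ π := by intro h; rw [h] at hw2; linarith [pi_pos]
  have h3 : Complex.arg (z * w) ≠ π := by intro h; rw [hmul] at h; linarith
  rw [argB_eq_arg h1, argB_eq_arg h2, argB_eq_arg h3, hmul]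

/-- kernel: argB(e^{it}) = t for t ∈ [−π, π) (the printed range of (2.11)). [cite: BalabanImbrieJaffe1985, (2.11) p.303] -/
theorem argB_exp_mul_I {t : ℝ} (ht : t ∈ Set.Ico (-π) π) : argB (Complex.exp (t * Complex.I)) = t := by
  rcases eq_or_lt_of_le ht.1 with h | h
  · -- t = −π: e^{−iπ} = −1, arg = π, argB = −π
    rw [← h]
    have hexp : Complex.exp (((-π : ℝ) : ℂ) * Complex.I) = -1 := by
      push_cast
      rw [neg_mul, Complex.exp_neg, Complex.exp_pi_mul_I]
      norm_num
    rw [hexp, argB, Complex.arg_neg_one, if_pos rfl]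
  · have hmem : t ∈ Set.Ioc (-π) (-π + 2 * π) := ⟨h, by linarith [ht.2]⟩
    have harg : Complex.arg (Complex.exp (t * Complex.I)) = t := by
      rw [Complex.arg_exp_mul_I, toIocMod_eq_self]
      exact hmem
    rw [argB_eq_arg (by rw [harg]; exact ne_of_lt ht.2), harg]

/-! ## 2. (6.3) = (4.2.4) = (3.14): the plaquette field f(p) = (ie)^{−1} ln u(∂p) -/

/-- **(6.3)** p. 318 [PDF 20], verbatim: *"The plaquette field f^{(k)}(p) = (ie_k)^{−1} ln u(∂p), p ∈ T₁, (6.3)"* (also (4.2.4)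
p. 310 and, on the L-lattice with e(Lε), the field F of (3.14) p. 307: *"v(p′) ≡ Π_{b′∈∂p′} v_{b′} ≡ exp[ie(Lε)F(p′)]"*) — with
the branch (2.11): the real number argB(u(p))/e. [cite: BalabanImbrieJaffe1985, (6.3) p.318] -/
def plaqField (e : ℝ) (u : U1Field P j) (p : Plaq P j) : ℝ := argB ((plaq u p : Circle) : ℂ) / e

/-- kernel: e^{ief(p)} = u(p) (e ≠ 0) — (6.3)/(3.14) read as a definition of f by its exponential. [cite: BalabanImbrieJaffe1985, (6.3) p.318] -/
theorem exp_plaqField (e : ℝ) (he : e ≠ 0) (u : U1Field P j) (p : Plaq P j) :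
    Complex.exp ((e * plaqField e u p : ℝ) * Complex.I) = ((plaq u p : Circle) : ℂ) := by
  have : e * plaqField e u p = argB ((plaq u p : Circle) : ℂ) := by
    unfold plaqField
    field_simp
  rw [this, exp_argB]

/-- kernel: Re u(p) = cos(ef(p)) — the Wilson term as a function of the plaquette field. [cite: BalabanImbrieJaffe1985, (3.13) p.307] -/
theorem re_plaq_eq_cos (e : ℝ) (he : e ≠ 0) (u : U1Field P j) (p : Plaq P j) :
    ((plaq u p : Circle) : ℂ).re = Real.cos (e * plaqField e u p) := by
  rw [← exp_plaqField e he u p, Complex.exp_ofReal_mul_I_re]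

/-! ## 3. (6.2): the translation u = u′·Q^{s*}v and u′ = exp(ie_kB′) -/

/-- **(6.2)** p. 318 [PDF 20], verbatim: *"on the unit lattice let u = u′Q^{s*}v, u′ = exp(ie_kB′). (6.2)"* — the bondwise
product of two U(1) fields (`w` = Q^{s*}v supplied, e.g. `BIJ85Sect2SurfaceAverages.BlockBonds.QsstarGroup`).
[cite: BalabanImbrieJaffe1985, (6.2) p.318] -/
def translate62 (u' w : U1Field P j) : U1Field P j := fun b => u' b * w b

/-- kernel: u(p) = u′(p)·(Q^{s*}v)(p) — U(1) is abelian, so plaquette variables factor. [cite: BalabanImbrieJaffe1985, (6.2) p.318] -/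
theorem plaq_translate62 (u' w : U1Field P j) (p : Plaq P j) :
    plaq (translate62 u' w) p = plaq u' p * plaq w p := by
  simp only [plaq, translate62]
  apply Circle.ext
  push_cast
  field_simp

/-- The unit-spacing plaquette sum of a real bond field, (∂B)(p) = B(∂p) = B(x,μ) + B(x+e_μ,ν) − B(x+e_ν,μ) − B(x,ν)
(= `…Balaban1983to89.LatticeFieldCalculus.curl 1`, same orientation as `plaq`). [cite: BalabanImbrieJaffe1985, (6.4) p.318] -/
def curl1 (B : PBond P j → ℝ) (p : Plaq P j) : ℝ :=
  B ⟨p.src, p.μ⟩ + B ⟨p.src.shift p.μ, p.ν⟩ - B ⟨p.src.shift p.ν, p.μ⟩ - B ⟨p.src, p.ν⟩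

/-- **(6.2)**, second half: *"u′ = exp(ie_kB′)"* bondwise. [cite: BalabanImbrieJaffe1985, (6.2) p.318] -/
def expField (e : ℝ) (B : PBond P j → ℝ) : U1Field P j := fun b => Circle.exp (e * B b)

/-- kernel: u′(∂p) = exp(ie(∂B′)(p)) for u′ = exp(ieB′). [cite: BalabanImbrieJaffe1985, (6.4) p.318] -/
theorem plaq_expField (e : ℝ) (B : PBond P j → ℝ) (p : Plaq P j) :
    plaq (expField e B) p = Circle.exp (e * curl1 B p) := by
  simp only [plaq, expField, curl1, ← Circle.exp_neg, ← Circle.exp_add]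
  congr 1
  ring

/-! ## 4. (6.4): the decomposition of the plaquette field in the small-field region -/

/-- **(6.4)** p. 318 [PDF 20], verbatim: *"f^{(k)}(p) = (ie_k)^{−1} ln u′(∂p) + (ie_k)^{−1} ln(Q^{s*}v)(∂p) = (∂B′)(p) +
L^{−d/2}(Q^{e*}f^{(k+1)})(p), (6.4) which is valid as long as u′(p) and (Q^{s*}_kv)(p) are close to 1."* — the FIRST equality,
PROVED in the small-field region |arg u′(p)| < π/2, |arg(Q^{s*}v)(p)| < π/2 (T1: the identification of the second summand
with L^{−d/2}Q^{e*}f^{(k+1)} is not performed). [cite: BalabanImbrieJaffe1985, (6.4) p.318] -/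
theorem eq64_smallField (e : ℝ) (u' w : U1Field P j) (p : Plaq P j)
    (hu : |Complex.arg ((plaq u' p : Circle) : ℂ)| < π / 2) (hw : |Complex.arg ((plaq w p : Circle) : ℂ)| < π / 2) :
    plaqField e (translate62 u' w) p = plaqField e u' p + plaqField e w p := by
  unfold plaqField
  rw [plaq_translate62, Circle.coe_mul, argB_mul_of_small (Circle.coe_ne_zero _) (Circle.coe_ne_zero _) hu hw, add_div]

/-- **(6.4)**, the first summand: *"(ie_k)^{−1} ln u′(∂p) = (∂B′)(p)"* for u′ = exp(ie_kB′) — PROVED whenever the plaquette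
sum is small, |e(∂B′)(p)| < π (no winding of the branch (2.11)); e ≠ 0. [cite: BalabanImbrieJaffe1985, (6.4) p.318] -/
theorem plaqField_expField (e : ℝ) (he : e ≠ 0) (B : PBond P j → ℝ) (p : Plaq P j) (hsmall : |e * curl1 B p| < π) :
    plaqField e (expField e B) p = curl1 B p := by
  unfold plaqField
  rw [plaq_expField, Circle.coe_exp]
  have hmem : e * curl1 B p ∈ Set.Ico (-π) π := ⟨(abs_lt.mp hsmall).1.le, (abs_lt.mp hsmall).2⟩
  rw [show ((e * curl1 B p : ℝ) : ℂ) * Complex.I = ((e * curl1 B p : ℝ)) * Complex.I from rfl, argB_exp_mul_I hmem]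
  field_simp

/-! ## 5. (3.13): the Wilson action as ½Σf² up to O(e(ε)²), with the split inserted -/

/-- **(3.13)** p. 307 [PDF 9] with p. 301: *"Σ_{p∈T₁} e(ε)^{−2}(1 − Re u(p)) = ½Σ_{p∈T₁}|∂A′ + L^{−d/2}Q^{e*}F|² + O(e(ε)²). (3.13)"*,
*"for small f_p, Σ_p e(ε)^{−2}(1 − Re u(p)) = Σ_p ½f_p² + O(e(ε)²)"* — PROVED with the explicit constant of
`BIJ85Sect1Model.wilson_quadratic_approx`: in the small-field region |ef(p)| ≤ 1,
|Σ_p e^{−2}(1 − Re u(p)) − ½Σ_p f(p)²| ≤ (5/96)e²Σ_p f(p)⁴, f = `plaqField e u`. [cite: BalabanImbrieJaffe1985, (3.13) p.307] -/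
theorem eq313 (e : ℝ) (he : e ≠ 0) (u : U1Field P j) (hsmall : ∀ p : Plaq P j, |e * plaqField e u p| ≤ 1) :
    |(∑ p : Plaq P j, e⁻¹ ^ 2 * (1 - ((plaq u p : Circle) : ℂ).re)) - ∑ p : Plaq P j, plaqField e u p ^ 2 / 2| ≤
      5 / 96 * e ^ 2 * ∑ p : Plaq P j, plaqField e u p ^ 4 := by
  rw [← Finset.sum_sub_distrib, Finset.mul_sum]
  refine (Finset.abs_sum_le_sum_abs _ _).trans (Finset.sum_le_sum fun p _ => ?_)
  rw [re_plaq_eq_cos e he u p]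
  exact wilson_quadratic_approx e _ he (hsmall p)

/-- **(3.13)** with the split of (3.9)–(3.12)/(6.4) inserted: for u = u′·w (u′ = the block-average-1 field exp(ie(ε)A′), w =
Q^{s*}v) in the small-field region, |Σ_p e^{−2}(1 − Re u(p)) − ½Σ_p(f_{u′}(p) + f_w(p))²| ≤ (5/96)e²Σ_p(f_{u′}(p) + f_w(p))⁴ —
the printed "½Σ|∂A′ + L^{−d/2}Q^{e*}F|² + O(e(ε)²)" with f_{u′} = ∂A′ (`plaqField_expField`) and f_w in the rôle of
L^{−d/2}Q^{e*}F (T1). [cite: BalabanImbrieJaffe1985, (3.13) p.307] -/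
theorem eq313_split (e : ℝ) (he : e ≠ 0) (u' w : U1Field P j)
    (hu : ∀ p : Plaq P j, |Complex.arg ((plaq u' p : Circle) : ℂ)| < π / 2)
    (hw : ∀ p : Plaq P j, |Complex.arg ((plaq w p : Circle) : ℂ)| < π / 2)
    (hsmall : ∀ p : Plaq P j, |e * (plaqField e u' p + plaqField e w p)| ≤ 1) :
    |(∑ p : Plaq P j, e⁻¹ ^ 2 * (1 - ((plaq (translate62 u' w) p : Circle) : ℂ).re)) -
        ∑ p : Plaq P j, (plaqField e u' p + plaqField e w p) ^ 2 / 2| ≤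
      5 / 96 * e ^ 2 * ∑ p : Plaq P j, (plaqField e u' p + plaqField e w p) ^ 4 := by
  have h64 : ∀ p : Plaq P j, plaqField e (translate62 u' w) p = plaqField e u' p + plaqField e w p :=
    fun p => eq64_smallField e u' w p (hu p) (hw p)
  have h := eq313 e he (translate62 u' w) (fun p => by rw [h64 p]; exact hsmall p)
  simp_rw [h64] at h
  exact h

end

end Literature.MathematicalPhysics.QuantumFieldTheory.BalabanImbrieJaffe1984to88.BIJ85SmallFieldSplit64
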